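import Mathlib

/-!
# Route «KPlusLogSqLaw», crux `WeakLifting` (stmt-ValiantsHypothesis-19561) — REAL side of the tridiagonal sector:
# the analytic brick of every hierarchical construction — ONE MOVE of the limit game at finite slope (sign transfer at finitely many points)

HONEST FRAMING.  Helper (`--supports stmt-ValiantsHypothesis-19561 --as helper`), seat val-sym-lift-p1 (g11), cell `pub-symmetroid`, 2026-08-27.  Pure
real analysis, no matrices: the lemma that turns a move of the HIERARCHICAL LIMIT GAME (val-sym-lift-p3 g9; this seat's rotating-detector ladder,
memo ROTATING-DETECTOR-liftp1g11.md §3b) into a statement about an actual continuant at FINITE slope.  Appending one edge of weight `κ x^L` to a static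
tridiagonal design replaces the top pair `(p, q) = (P_n, P_(n−1))` by `P_(n+1) = p − κ x^L q`; the game says «`P_(n+1)` has the sign of `p` left of the switch
and the sign of `−q` right of it».  Here: for any two finite families of positive sample points separated by a gap `r₁ < r₂`, at which `p` resp. `q` do
not vanish, there ARE a slope `L : ℕ` and a coefficient `κ > 0` realising exactly that sign pattern (`exists_move_signs`); the switch is placed by
`exists_pow_switch` (`κ r₁^L ≤ 1/M`, `κ r₂^L ≥ M` for any `M`, from `(r₁/r₂)^L → 0`).  Iterating the lemma level by level is how the seat's ladder
(`+3` zeros per two edges) and lift-p3's pump (`2m − 6`) are realised; what this file does NOT provide is the choice of the NEW sample points inside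
the freshly created tight pairs (that needs the zeros of `P_(n+1)` located, an IVT step per move) — so no `∀ m` row is claimed here.  Nothing here is an
upper bound; nothing bears on `WeakLifting` / `TropicalB` in their windows, Conjecture B, the doors, `MatrixDescartes` (stmt-18050) or VP ≠ VNP.
[folklore: Archimedean placement; data-free]
-/

-- `Summit.ValiantsHypothesis.ValiantsHypothesis.…` repeats a component by the D-0017 layout (single-conjunct summit); the name is mandated.
set_option linter.dupNamespace false
set_option autoImplicit false

namespace Summit.ValiantsHypothesis.ValiantsHypothesis.Theorems.KPlusLogSqLaw.StaticTridiagonalRealExcess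

open Finset

/-- **Placing a switch.**  For `0 < r₁ < r₂` and any `M > 0` there are `L : ℕ` and `κ > 0` with `κ · r₁ ^ L ≤ 1 / M` and `M ≤ κ · r₂ ^ L`
(take `κ = M / r₂^L` and `L` with `(r₁/r₂)^L ≤ 1/M²`). [folklore] -/
theorem exists_pow_switch {r₁ r₂ M : ℝ} (h₁ : 0 < r₁) (h₁₂ : r₁ < r₂) (hM : 0 < M) :
    ∃ (L : ℕ) (κ : ℝ), 0 < κ ∧ κ * r₁ ^ L ≤ 1 / M ∧ M ≤ κ * r₂ ^ L := by
  have h₂ : 0 < r₂ := h₁.trans h₁₂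
  have hρ0 : 0 ≤ r₁ / r₂ := div_nonneg h₁.le h₂.le
  have hρ1 : r₁ / r₂ < 1 := (div_lt_one h₂).mpr h₁₂
  have hM2 : 0 < 1 / M ^ 2 := by positivity
  obtain ⟨L, hL⟩ := exists_pow_lt_of_lt_one hM2 hρ1
  refine ⟨L, M / r₂ ^ L, div_pos hM (pow_pos h₂ L), ?_, ?_⟩
  · -- κ r₁^L = M (r₁/r₂)^L ≤ M / M² = 1/M
    have hr2L : 0 < r₂ ^ L := pow_pos h₂ L
    have : M / r₂ ^ L * r₁ ^ L = M * (r₁ / r₂) ^ L := by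
      rw [div_pow]; field_simp
    rw [this]
    calc M * (r₁ / r₂) ^ L ≤ M * (1 / M ^ 2) := by
            exact mul_le_mul_of_nonneg_left hL.le hM.le
      _ = 1 / M := by field_simp
  · have hr2L : 0 < r₂ ^ L := pow_pos h₂ L
    rw [div_mul_cancel₀ M hr2L.ne']

/-- **ONE MOVE OF THE HIERARCHICAL GAME AT FINITE SLOPE (sign transfer).**  Let `p q : ℝ → ℝ`, let `xs` be a finite set of points in `(0, r₁]` at which
`p ≠ 0` and `ys` a finite set of points in `[r₂, ∞)` at which `q ≠ 0`, with `0 < r₁ < r₂`.  Then there are `L : ℕ` and `κ > 0` such that the appended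
continuant `t ↦ p t − κ t^L q t` has the SIGN OF `p` at every point of `xs` and the SIGN OF `−q` at every point of `ys` (precisely: the products
`(p x − κ x^L q x) · p x` and `−(p y − κ y^L q y) · q y` are positive).  This is the finite-slope content of «left of the switch the new polynomial copies
`P_n`, right of it `−W·P_(n−1)`». [folklore: Archimedean] -/
theorem exists_move_signs (p q : ℝ → ℝ) (xs ys : Finset ℝ) {r₁ r₂ : ℝ} (h₁ : 0 < r₁) (h₁₂ : r₁ < r₂)
    (hxs : ∀ x ∈ xs, 0 < x ∧ x ≤ r₁ ∧ p x ≠ 0) (hys : ∀ y ∈ ys, r₂ ≤ y ∧ q y ≠ 0) :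
    ∃ (L : ℕ) (κ : ℝ), 0 < κ ∧
      (∀ x ∈ xs, 0 < (p x - κ * x ^ L * q x) * p x) ∧
      (∀ y ∈ ys, 0 < -((p y - κ * y ^ L * q y) * q y)) := by
  have h₂ : 0 < r₂ := h₁.trans h₁₂
  -- a common margin M exceeding every ratio |q x| / |p x| (x ∈ xs) and |p y| / |q y| (y ∈ ys)
  set M : ℝ := 1 + ∑ x ∈ xs, |q x| / |p x| + ∑ y ∈ ys, |p y| / |q y| with hMdef
  have hS1 : 0 ≤ ∑ x ∈ xs, |q x| / |p x| := Finset.sum_nonneg fun x _ => div_nonneg (abs_nonneg _) (abs_nonneg _)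
  have hS2 : 0 ≤ ∑ y ∈ ys, |p y| / |q y| := Finset.sum_nonneg fun y _ => div_nonneg (abs_nonneg _) (abs_nonneg _)
  have hM : 0 < M := by rw [hMdef]; linarith
  have hM1 : 1 ≤ M := by rw [hMdef]; linarith
  obtain ⟨L, κ, hκ, hlow, hhigh⟩ := exists_pow_switch h₁ h₁₂ hM
  refine ⟨L, κ, hκ, ?_, ?_⟩
  · intro x hx
    obtain ⟨hx0, hxr, hpx⟩ := hxs x hx
    -- κ x^L ≤ κ r₁^L ≤ 1/M and |q x| ≤ (M - 1)|p x| < M |p x|  ⇒  κ x^L |q x| < |p x|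
    have hxL : κ * x ^ L ≤ 1 / M :=
      le_trans (mul_le_mul_of_nonneg_left (pow_le_pow_left₀ hx0.le hxr L) hκ.le) hlow
    have hratio : |q x| / |p x| ≤ M - 1 := by
      have : |q x| / |p x| ≤ ∑ z ∈ xs, |q z| / |p z| :=
        Finset.single_le_sum (f := fun z => |q z| / |p z|) (fun z _ => div_nonneg (abs_nonneg _) (abs_nonneg _)) hx
      rw [hMdef]; linarith
    have hpabs : 0 < |p x| := abs_pos.mpr hpx
    have hq_le : |q x| ≤ (M - 1) * |p x| := by
      rwa [div_le_iff₀ hpabs] at hratio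
    have hkey : κ * x ^ L * |q x| < |p x| := by
      have hxLnn : 0 ≤ κ * x ^ L := mul_nonneg hκ.le (pow_nonneg hx0.le L)
      calc κ * x ^ L * |q x| ≤ (1 / M) * ((M - 1) * |p x|) :=
              mul_le_mul hxL hq_le (abs_nonneg _) (by positivity)
        _ < |p x| := by
              rw [div_mul_eq_mul_div, one_mul, div_lt_iff₀ hM]
              nlinarith
    -- conclude: (p x − κ x^L q x) · p x ≥ p x² − κ x^L |q x| |p x| > 0
    have h1 : (p x - κ * x ^ L * q x) * p x = p x ^ 2 - κ * x ^ L * (q x * p x) := by ring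
    rw [h1]
    have h2 : κ * x ^ L * (q x * p x) ≤ κ * x ^ L * (|q x| * |p x|) := by
      apply mul_le_mul_of_nonneg_left _ (mul_nonneg hκ.le (pow_nonneg hx0.le L))
      rw [← abs_mul]; exact le_abs_self _
    have h3 : p x ^ 2 = |p x| * |p x| := by rw [← sq, sq_abs]
    nlinarith [mul_lt_mul_of_pos_right hkey hpabs]
  · intro y hy
    obtain ⟨hyr, hqy⟩ := hys y hy
    have hy0 : 0 < y := h₂.trans_le hyr
    -- κ y^L ≥ κ r₂^L ≥ M and |p y| ≤ (M - 1) |q y| < M |q y| ≤ κ y^L |q y|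
    have hyL : M ≤ κ * y ^ L :=
      le_trans hhigh (mul_le_mul_of_nonneg_left (pow_le_pow_left₀ h₂.le hyr L) hκ.le)
    have hratio : |p y| / |q y| ≤ M - 1 := by
      have : |p y| / |q y| ≤ ∑ z ∈ ys, |p z| / |q z| :=
        Finset.single_le_sum (f := fun z => |p z| / |q z|) (fun z _ => div_nonneg (abs_nonneg _) (abs_nonneg _)) hy
      rw [hMdef]; linarith
    have hqabs : 0 < |q y| := abs_pos.mpr hqy
    have hp_le : |p y| ≤ (M - 1) * |q y| := by
      rwa [div_le_iff₀ hqabs] at hratio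
    have hkey : |p y| < κ * y ^ L * |q y| := by
      calc |p y| ≤ (M - 1) * |q y| := hp_le
        _ < M * |q y| := by nlinarith
        _ ≤ κ * y ^ L * |q y| := mul_le_mul_of_nonneg_right hyL (abs_nonneg _)
    have h1 : -((p y - κ * y ^ L * q y) * q y) = κ * y ^ L * q y ^ 2 - p y * q y := by ring
    rw [h1]
    have h2 : p y * q y ≤ |p y| * |q y| := by rw [← abs_mul]; exact le_abs_self _
    have h3 : q y ^ 2 = |q y| * |q y| := by rw [← sq, sq_abs]
    nlinarith [mul_lt_mul_of_pos_right hkey hqabs]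

end Summit.ValiantsHypothesis.ValiantsHypothesis.Theorems.KPlusLogSqLaw.StaticTridiagonalRealExcess
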